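import Summits.QuantumFields.BalabanUV.Beta.FP.PerfectTelescopingLimit
import Summits.QuantumFields.BalabanUV.Beta.GAN24.KSlotJMHolds

/-!
# `BalabanUV.Beta.FP.PerfectTelescopingHolds` — road «FP» for binder row D1, leaf N7 ∕ (MS-1), K-side, TRANSVERSE form: THE LIMIT IDENTITY HOLDS
# UNCONDITIONALLY at `d + 1 = 4`, `Lc ≥ 2`, every `m ≥ 1` — the rows of `PerfectTelescopingLimit.kPerf_pair_telescoping` are THEOREMS of the
# G-an2-4 lineage (`GAN24.RealRateKMHolds.tendsto_KTot_KPerf_holds`, `GAN24.KSlotJMHolds.kSlotJM_holds`) in the road's adopted units `sfStep`∕`smStep 3`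

HONEST FRAMING (cell contract, verbatim): «discharging `BetaPertH` makes Bałaban's UV stability UNCONDITIONAL — a real constructive-QFT
result; it is NOT the continuum limit and NOT the Clay problem.»  HONEST DEPENDENCY (verbatim): «continuum YM on T⁴ ⇐ BetaPertH ∧ nine
spine estimates (0/9 proved); BetaPertH ⇐ (D1) ∧ (D4) ∧ CAP+tail; G-an2-4 gates asym, D1 and NE2/3/4.»  THIS MODULE DISCHARGES NOTHING of
the wall: it instantiates `PerfectTelescopingLimit.kPerf_pair_telescoping` (hypotheses: entrywise convergence of the three unit-rescaled resolvent families,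
`j`-uniform decay ∕ bound) with gan24-p3's UNCONDITIONAL K-side theorems for the (j, m)-families at `d = 3`, `2 ≤ Lc`, `1 ≤ m` — X1m-K
(`RealRateKMHolds.tendsto_KTot_KPerf_holds`) and the `Decays`-currency K-slot (`KSlotJMHolds.kSlotJM_holds`) — BY NAME.  No `def`, no `Prop` minted,
nothing cited, 0 sorry.  0 wall binders; it is an identity between the road's OWN perfect resolvents `KPerf Lc (sfStep Lc) (smStep 3 Lc) m` on the
gauge-TRANSVERSE slice — NOT an entrywise statement about Γ (unavailable in the axial slice: an5 `K1aNeg`, owner's F-d1p3-g3-1), NOT SLICE-∞, NOT the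
window ∕ tail rows of `hasym_of_legInterface_avg`, NOT `hasym`, NOT D1, NOT `BetaPertH`, NOT continuum, NOT Clay.

ABSOLUTE RULE (cell charter, verbatim): «No internally-minted statement may enter as a cited fact. Every hypothesis is either kernel-proved
in this package or a verbatim quotation of a PUBLISHED theorem with page reference. The manuscript(s) under audit are NOT citable for their
own disputed steps — they are the thing under adjudication; programme-internal (2001/route/tribunal) claims are never citable.»

WHY (road FP owner d1-p3's N7 PLAN v1 §2 (MS-1), sub-row MS-1-FIN; `LEAVES-FP.md` row N7∕MS-1).  N7 PLAN (MS-1): «Γ_{Lc^{m+1}} = Γ_{Lc^m} +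
Σ H_{Lc^m} · C^{[Lc^m]} · H_{Lc^m}ᵀ, C^{[N]} := N^{−p_C}·C((u−u′)∕N) … SUPPLIERS: the finite-j two-level resolvent identities, stationarity N1, entrywise
limits.  CLASS: exact algebra + limits.»  This file closes that chain ON THE K-SIDE IN TRANSVERSE FORM with NO hypothesis left beyond the test forms:
finite level (`PerfectTelescopingFinite{,Composite,Units}`) + limits (`PerfectTelescopingLimit`, Tannery) + the G-an2-4 lineage's X1m-K ∕ K-slot theorems.

CONTENT (all [folklore] ∕ [our proof]; `d + 1 = 4`).
* `decays_le_const` (a `Decays` bound with nonnegative rate is a uniform bound), **`kPerf_pair_telescoping_holds`** — for every `Lc ≥ 2`, `m ≥ 1` and all finitely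
  supported CO-CLOSED test 1-forms `G, G′`:
  `⟨G, [KPerf Lc (sfStep Lc) (smStep 3 Lc) (m+1)]_ff G′⟩ = ⟨G, ([KPerf … m] − ((Lc^m)²)⁻¹·[KPerf … m ∘ liftW (Lc^m) true true (KPerf … 1) ∘ KPerf … m])_ff G′⟩`;
  **`kPerf_pair_telescoping_sum`** — iterated: «Γ_{Lc^{m+1}} = Γ_{Lc} + Σ_{k=1}^{m} H_{Lc^k} C^{[Lc^k]} H_{Lc^k}ᵀ» on transverse test forms (finite sums).
Unit `b2b-balaban-gan24-formalise-leaf-05` (gen 33; cross-lane idle G-an2-4 swarm leaf seat on road FP's sub-row MS-1-FIN).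
-/

noncomputable section

namespace Summit.QuantumFields.BalabanUV.Beta.FP.PerfectTelescopingHolds

open Finset Filter Topology
open scoped BigOperators
open Literature.MathematicalPhysics.QuantumFieldTheory.Balaban1983to89
open Literature.MathematicalPhysics.QuantumFieldTheory.Balaban1983to89.Beta
open B12Sec2to5 (l1 l1_nonneg)
open AffineAveraging (Form1 codiff₁)
open ExpKernelCalculus (MKer Decays comp)
open OneStepResolventKernel (Fib)
open OneStepKernelFamily (KInvStep)
open InterLevelTransport (liftW)
open Summit.QuantumFields.BalabanUV.Beta.HessKerDressedUnits (unitK)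
open Summit.QuantumFields.BalabanUV.Beta.GAN24.CombesThomas (sfStep smStep)
open Summit.QuantumFields.BalabanUV.Beta.GAN24.RealRateKMHolds (tendsto_KTot_KPerf_holds)
open Summit.QuantumFields.BalabanUV.Beta.GAN24.KSlotJMHolds (kSlotJM_holds)
open Summit.QuantumFields.BalabanUV.Beta.FP.PerfectObjects (KTot)
open Summit.QuantumFields.BalabanUV.Beta.FP.PerfectObjectsT (KPerf)
open Summit.QuantumFields.BalabanUV.Beta.FP.PerfectTelescopingLimit (kPerf_pair_telescoping)

/-- [folklore] A kernel decaying at a positive rate is uniformly bounded by its constant. -/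
theorem decays_le_const {d : ℕ} {K : MKer (d + 1) (Fib d)} {C δ : ℝ} (hK : Decays K C δ) (hδ : 0 ≤ δ) (x y : Fin (d + 1) → ℤ) (a b : Fib d) :
    |K x y a b| ≤ C := by
  refine (hK x y a b).trans (mul_le_of_le_one_right (hK.nonneg a) ?_)
  exact Real.exp_le_one_iff.mpr (by nlinarith [l1_nonneg (x - y)])

variable (Lc : ℕ) [NeZero Lc]

/-- [our proof] **(MS-1) ON THE K-SIDE, TRANSVERSE FORM, AT THE LIMIT — UNCONDITIONAL at `d + 1 = 4`, `Lc ≥ 2`, `m ≥ 1`.**  For all finitely supported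
CO-CLOSED test 1-forms `G, G′`, with `KPerf … m := KPerf Lc (sfStep Lc) (smStep 3 Lc) m` the perfect resolvent of the `m`-fold step in the adopted units:
`Σ'Σ'ΣΣ G κ x′ · [KPerf … (m+1)] x′ y′ (inl κ)(inl l) · G′ l y′
   = Σ'Σ'ΣΣ G κ x′ · ([KPerf … m] x′ y′ (inl κ)(inl l) − ((Lc^m)²)⁻¹ · [KPerf … m ∘ liftW (Lc^m) true true (KPerf … 1) ∘ KPerf … m] x′ y′ (inl κ)(inl l)) · G′ l y′`
— «Γ_{Lc^{m+1}} = Γ_{Lc^m} + H_{Lc^m} C^{[Lc^m]} H_{Lc^m}ᵀ with C^{[n]} = n^{−2}·(the perfect ONE-step kernel lifted onto n·ℤ⁴)», `n = Lc^m`, on the gauge-transverse slice: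
`PerfectTelescopingLimit.kPerf_pair_telescoping` with ALL its rows supplied — entrywise convergence of the (j, m+1)-, (j, m)- and (j, 1)-families
(`RealRateKMHolds.tendsto_KTot_KPerf_holds`), `j`-uniform `Decays` of the (j, m)-family and of the (j, 1)-family (`KSlotJMHolds.kSlotJM_holds`). -/
theorem kPerf_pair_telescoping_holds (hLc : 2 ≤ Lc) {m : ℕ} (hm : 1 ≤ m) (G G' : Form1 (3 + 1) ℝ)
    (hG : ∀ κ, (Function.support (G κ)).Finite) (hG' : ∀ κ, (Function.support (G' κ)).Finite)
    (hcoG : codiff₁ G = 0) (hcoG' : codiff₁ G' = 0) :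
    (∑' x', ∑' y', ∑ κ, ∑ l, G κ x'
        * KPerf (d := 3) Lc (sfStep Lc) (smStep 3 Lc) (m + 1) x' y' (Sum.inl κ) (Sum.inl l) * G' l y')
      = ∑' x', ∑' y', ∑ κ, ∑ l, G κ x' *
          (KPerf (d := 3) Lc (sfStep Lc) (smStep 3 Lc) m x' y' (Sum.inl κ) (Sum.inl l)
            - (((Lc : ℝ) ^ m) * ((Lc : ℝ) ^ m))⁻¹
              * comp (KPerf (d := 3) Lc (sfStep Lc) (smStep 3 Lc) m)
                  (comp (liftW (Lc ^ m) true true (KPerf (d := 3) Lc (sfStep Lc) (smStep 3 Lc) 1))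
                    (KPerf (d := 3) Lc (sfStep Lc) (smStep 3 Lc) m))
                  x' y' (Sum.inl κ) (Sum.inl l)) * G' l y' := by
  -- the K-slot rows of the (j, m)- and (j, 1)-families, unconditional
  obtain ⟨CB, δB, _, _, hδB, _, _, hBd, _⟩ := kSlotJM_holds (Lc := Lc) hLc hm
  obtain ⟨C1, δ1, _, _, hδ1, _, _, h1d, _⟩ := kSlotJM_holds (Lc := Lc) hLc (le_refl 1)
  have hsf : (sfStep Lc) = fun j => (Lc : ℝ) ^ j := rfl
  have hsm : (smStep 3 Lc) = fun j => (Lc : ℝ) ^ (j * (3 + 1)) := rfl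
  rw [hsf, hsm]
  refine kPerf_pair_telescoping (d := 3) Lc (by omega) m (CB := CB) (δB := δB) (CS := C1) hδB ?_ ?_ ?_ ?_ ?_ G G' hG hG' hcoG hcoG'
  · intro x y a b
    exact ⟨_, tendsto_KTot_KPerf_holds hLc (m := m + 1) (by omega) x y a b⟩
  · intro x y a b
    exact ⟨_, tendsto_KTot_KPerf_holds hLc hm x y a b⟩
  · intro x y a b
    exact ⟨_, tendsto_KTot_KPerf_holds hLc (m := 1) le_rfl x y a b⟩
  · exact hBd
  · intro j z w a b
    exact decays_le_const (h1d j) hδ1.le z w a b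


/-- [our proof] **THE MULTISCALE SUM — «Γ_{Lc^{m+1}} = Γ_{Lc} + Σ_{k=1}^{m} H_{Lc^k} C^{[Lc^k]} H_{Lc^k}ᵀ» ON THE TRANSVERSE SLICE, UNCONDITIONAL** (`d + 1 = 4`, `Lc ≥ 2`):
for finitely supported CO-CLOSED `G, G′` (supported in the finsets `s`, `s′`) and every `m`,
`Σ_{x′∈s} Σ_{y′∈s′} ΣΣ G·[KPerf … (m+1)]·G′ = Σ Σ ΣΣ G·[KPerf … 1]·G′ − Σ_{k<m} ((Lc^(k+1))²)⁻¹ · Σ Σ ΣΣ G·[KPerf … (k+1) ∘ liftW (Lc^(k+1)) true true (KPerf … 1) ∘ KPerf … (k+1)]·G′`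
— `kPerf_pair_telescoping_holds` iterated (finite sums, so plain linearity). -/
theorem kPerf_pair_telescoping_sum (hLc : 2 ≤ Lc) (G G' : Form1 (3 + 1) ℝ) (s s' : Finset (Fin (3 + 1) → ℤ))
    (hs : ∀ κ x, x ∉ s → G κ x = 0) (hs' : ∀ κ x, x ∉ s' → G' κ x = 0)
    (hG : ∀ κ, (Function.support (G κ)).Finite) (hG' : ∀ κ, (Function.support (G' κ)).Finite)
    (hcoG : codiff₁ G = 0) (hcoG' : codiff₁ G' = 0) (m : ℕ) :
    (∑ x' ∈ s, ∑ y' ∈ s', ∑ κ, ∑ l, G κ x' * KPerf (d := 3) Lc (sfStep Lc) (smStep 3 Lc) (m + 1) x' y' (Sum.inl κ) (Sum.inl l) * G' l y')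
      = (∑ x' ∈ s, ∑ y' ∈ s', ∑ κ, ∑ l, G κ x' * KPerf (d := 3) Lc (sfStep Lc) (smStep 3 Lc) 1 x' y' (Sum.inl κ) (Sum.inl l) * G' l y')
        - ∑ k ∈ Finset.range m, (((Lc : ℝ) ^ (k + 1)) * ((Lc : ℝ) ^ (k + 1)))⁻¹
          * ∑ x' ∈ s, ∑ y' ∈ s', ∑ κ, ∑ l, G κ x'
            * comp (KPerf (d := 3) Lc (sfStep Lc) (smStep 3 Lc) (k + 1))
                (comp (liftW (Lc ^ (k + 1)) true true (KPerf (d := 3) Lc (sfStep Lc) (smStep 3 Lc) 1))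
                  (KPerf (d := 3) Lc (sfStep Lc) (smStep 3 Lc) (k + 1)))
                x' y' (Sum.inl κ) (Sum.inl l) * G' l y' := by
  induction m with
  | zero => simp
  | succ m ih =>
    have h := kPerf_pair_telescoping_holds Lc hLc (m := m + 1) (by omega) G G' hG hG' hcoG hcoG'
    rw [ResolventCompositionStepB.tsum_pair_eq_sum G G' s s' hs hs', ResolventCompositionStepB.tsum_pair_eq_sum G G' s s' hs hs'] at h
    rw [h, Finset.sum_range_succ]
    have split : (∑ x' ∈ s, ∑ y' ∈ s', ∑ κ, ∑ l, G κ x' *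
          (KPerf (d := 3) Lc (sfStep Lc) (smStep 3 Lc) (m + 1) x' y' (Sum.inl κ) (Sum.inl l)
            - (((Lc : ℝ) ^ (m + 1)) * ((Lc : ℝ) ^ (m + 1)))⁻¹
              * comp (KPerf (d := 3) Lc (sfStep Lc) (smStep 3 Lc) (m + 1))
                  (comp (liftW (Lc ^ (m + 1)) true true (KPerf (d := 3) Lc (sfStep Lc) (smStep 3 Lc) 1))
                    (KPerf (d := 3) Lc (sfStep Lc) (smStep 3 Lc) (m + 1)))
                  x' y' (Sum.inl κ) (Sum.inl l)) * G' l y')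
        = (∑ x' ∈ s, ∑ y' ∈ s', ∑ κ, ∑ l, G κ x' * KPerf (d := 3) Lc (sfStep Lc) (smStep 3 Lc) (m + 1) x' y' (Sum.inl κ) (Sum.inl l) * G' l y')
          - (((Lc : ℝ) ^ (m + 1)) * ((Lc : ℝ) ^ (m + 1)))⁻¹
            * ∑ x' ∈ s, ∑ y' ∈ s', ∑ κ, ∑ l, G κ x'
              * comp (KPerf (d := 3) Lc (sfStep Lc) (smStep 3 Lc) (m + 1))
                  (comp (liftW (Lc ^ (m + 1)) true true (KPerf (d := 3) Lc (sfStep Lc) (smStep 3 Lc) 1))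
                    (KPerf (d := 3) Lc (sfStep Lc) (smStep 3 Lc) (m + 1)))
                  x' y' (Sum.inl κ) (Sum.inl l) * G' l y' := by
      simp only [Finset.mul_sum, ← Finset.sum_sub_distrib]
      refine Finset.sum_congr rfl fun x' _ => Finset.sum_congr rfl fun y' _ => Finset.sum_congr rfl fun κ _ =>
        Finset.sum_congr rfl fun l _ => by ring
    rw [split, ih]
    ring

end Summit.QuantumFields.BalabanUV.Beta.FP.PerfectTelescopingHolds

end
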